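import Summits.HodgeConjecture.HodgeConjecture.Theses.TropicalCuspLift
import Summits.HodgeConjecture.HodgeConjecture.Theorems.HodgeAbelianVarieties.Negative.ExtremeCodimensions
import Literature.AlgebraicGeometry.HodgeTheory.WeilClasses
import Literature.AlgebraicGeometry.HodgeTheory.WeilClassesFourfolds
import Literature.AlgebraicGeometry.HodgeTheory.AbelianLowDimensionHodgeConjecture
import Literature.AlgebraicGeometry.HodgeTheory.HodgeClassesDimLEThreeProofs
import Literature.AlgebraicGeometry.HodgeTheory.ComplexConjugationHolds
import Literature.AlgebraicGeometry.HodgeTheory.AlgebraicClassesCupAbelianVariety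
import Literature.AlgebraicGeometry.HodgeTheory.WeilClassesSurfacesProofs
import Literature.AlgebraicGeometry.HodgeTheory.WeilClassesFourfoldsProofs
import Literature.Barriers.HodgeConjecture.ExceptionalHodgeClasses
import Literature.AlgebraicGeometry.HodgeTheory.AbelianLowDimensionWeilReduction

/-!
# Crux `HodgeAbelianVarieties` (stmt-HodgeConjecture-1333), line `e-step-secant-induction` — stub `stub_weilSectorSuffices`: the known partials

The registered stub (skeleton `Cruxes/HodgeAbelianVarieties/Lines/e_step_secant_induction.lean`,
gen 3) is the HC-hard COMPLEMENT of the line,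
`WeilSectorSuffices := TropicalCuspLift.WeilClassesAlgebraic → PadicSemiregularLift.HodgeAbelianVarieties`:
the imaginary-quadratic Weil sector (Weil classes algebraic on every Weil-type `(A, φ)`, `φ ≫ φ = -d`,
all `2n ≥ 4`, all `K = ℚ(√-d)`; stmt-HodgeConjecture-2522) implies the Hodge conjecture for every
complex abelian variety. It is OPEN (its open parts in print: Weil classes for CM fields of degree
`> 2`, Markman arXiv:2509.23403 Thm. 1.4 / §12, and the CM-to-general transport) and is NOT proved
here. This file lands, sorry-free, what print knows of it, over the two route decls directly:

* `weilSectorSuffices_dim_le_five` (REGISTERED sub-goal) — **the Weil sector suffices up to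
  dimension `5`**: `MoonenZarhin1999_… → TropicalCuspLift.WeilClassesAlgebraic →
  ∀ A : AbelianVariety ℂ, A.dim ≤ 5 → HodgeConjectureFor A.dim A.X`, where the first hypothesis is
  the NAMED FACT (stated below in `Literature.AlgebraicGeometry.HodgeTheory`, for the gate to
  relocate) recording the Moonen–Zarhin reduction (Math. Ann. 315 (1999) Thms. 0.1–0.2, with
  Moonen–Zarhin 1995 and Tankeev for the simple cases and Ramón Marí 2008 Prop. 2.18 for products of
  abelian surfaces, as combined in Markman arXiv:2509.23403 §1.1 / Cor. 1.3 and its Abstract: "The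
  Hodge conjecture for abelian varieties of dimension `≤ 5` is known to follow from the latter result
  (sc. the algebraicity of the Weil classes on all abelian fourfolds of Weil type)"): the fourfold Weil
  fact `Markman2025_weilClasses_algebraic_abelianFourfold` IMPLIES the `dim ≤ 5` fact
  `Markman2025_hodgeClasses_algebraic_abelian_dim_le_five` (both already in the tree; the second is
  tagged an unrefereed claim — the new fact is the refereed bridge between them). The route antecedent
  at `n = 2` IS the fourfold fact (`weilClassesFourfolds_of_weilClassesAlgebraic`, dictionary
  `mem_weilClassesOf_iff`), and the anti-vacuity conjunct `Nonempty (HodgeModel _ _)` is DISCHARGED by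
  the tree's theorem `nonempty_hodgeModel_holds` (Serre GAGA + de Rham + Hodge decomposition).
* `weilSectorSuffices_of_six_le_dim` (REGISTERED sub-goal) — the honest residual form of the stub:
  granted the Moonen–Zarhin fact and the Weil sector, the crux IS its part `dim A ≥ 6`
  (`hodgeAbelianVarieties_iff_six_le_dim`).
* `hodgeAbelianVarieties_dim_le_three` (REGISTERED sub-goal) — `dim A ≤ 3` from the tree's named
  fact `hodgeClasses_algebraic_of_dim_le_three` alone (CONDITIONAL on it; its own reduction to
  Lefschetz `(1,1)` + the Lefschetz isomorphism of a threefold is `hodgeClasses_algebraic_of_dim_le_three_of`,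
  whence `hodgeAbelianVarieties_dim_le_three_of_lefschetz`), Hodge models discharged — no Weil input.
* `hodgeConjectureFor_of_divisorGenerated` (REGISTERED sub-goal) — the DIVISOR-GENERATED sector
  (Mattuck, Tate–Imai–Murasaki, Tankeev–Ribet: `Bᵖ = Dᵖ`): granted Lefschetz `(1,1)`, an abelian
  variety all of whose rational `(p,p)`-classes lie in `divisorClassesSpan A.X A.dim p` (the `ℂ`-span
  of `p`-fold cup products of rational `(1,1)`-classes, barrier file `ExceptionalHodgeClasses`)
  satisfies `HodgeConjectureFor A.dim A.X` — products with divisor classes stay algebraic on an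
  abelian variety by the tree's THEOREM `AbelianVariety.cupProduct_mem_algebraicClasses_one`
  (Kleiman moving by translations); `divisorClassesSpan_le_algebraicClasses`.
* AUDIT of the stub's shape (P4): the antecedent `TropicalCuspLift.WeilClassesAlgebraic` is implied
  by the crux (`weilClassesAlgebraic_of_hodgeAbelianVarieties`), so the stub is equivalent to
  `HodgeAbelianVarieties ∨ ¬ WeilClassesAlgebraic` (`weilSectorSuffices_iff`): "if HC fails on some
  abelian variety, it already fails at a rational `(n,n)`-class of the Weil plane `E₊ ⊔ E₋` of some
  `(A²ⁿ, φ² = -d)`, `n ≥ 2`" — a genuinely open statement, neither junk-true (the antecedent is not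
  refutable for a typing reason: its Weil plane is cut out by the SIMULTANEOUS eigen-conditions of all
  `(x·𝟙 + y·φ)^*`, `x y : ℕ`, whose two characters `(x ± iy√d)²ⁿ` are separated for every `d ≥ 1`,
  `disjoint_weilClassesPlus_weilClassesMinus` — no `d ∈ {1,3}` collision as for the single test
  endomorphism `(𝟙 + φ)^*` of `Motives.exists_cmWeilSurface_aimedSplitProduct`; `IsRationalClass`,
  `IsOfHodgeType`, `algebraicClasses` are the summit's own carriers, so a witness against it is a
  counterexample to HC) nor junk-false (it is implied by the crux — `fun h _ ↦ h` — hence by `HodgeConjecture`). Its binders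
  `(n, d, A, φ)` are inhabited for every `n ≥ 1`, `d ≥ 1` (`exists_abelianVariety_comp_self_eq_neg`:
  self-products of the tree's Weil surface `E_i × E_i`, PROVED) and its hypothesis list is satisfiable
  at `c = 0` on every instance (`weilClassesAlgebraic_hypotheses_zero`).

Not attempted (census): the CM sector beyond `dim ≤ 5` (André 1992: landed separately as
`Theorems/PadicSemiregularLiftHodgeAbelianVarietiesStubAndreCM`, residues `AndreSplitWeil[]`,
`HomPullback[]`); Weil classes for CM fields of degree `> 2`; the CM-to-general transport.
-/

set_option linter.dupNamespace false

noncomputable section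

open CategoryTheory
open Literature.AlgebraicGeometry Literature.AlgebraicGeometry.Motives
  Literature.AlgebraicGeometry.HodgeTheory

/-! ### The named fact: Moonen–Zarhin's reduction of `dim ≤ 5` to the Weil classes of fourfolds -/

namespace Literature.AlgebraicGeometry.HodgeTheory

end Literature.AlgebraicGeometry.HodgeTheory

namespace Summit.HodgeConjecture.HodgeConjecture.Cruxes.HodgeAbelianVarieties.EStepSecantInduction.Stubs.WeilSector

open Literature.AlgebraicTopology.SingularHomology
open Summit.HodgeConjecture.HodgeConjecture.Theorems.HodgeAbelianVarieties

/-! ### Upper bound: the named fact is a fragment of the Hodge conjecture -/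

/-- The Hodge conjecture for all smooth projective varieties implies the Moonen–Zarhin reduction
(its conclusion is the cycle part of the conjecture on abelian varieties of dimension `≤ 5`), so the
fact claims nothing beyond the summit. [cite: Deligne2000, §1] -/
theorem MoonenZarhin1999_hodgeClasses_abelian_dim_le_five_of_weilClassesFourfolds_of_hodgeConjectureFor
    (h : ∀ ⦃n : ℕ⦄ ⦃X : SchemeOver ℂ⦄, IsSmoothProjective n X → HodgeConjectureFor n X) :
    Literature.AlgebraicGeometry.HodgeTheory.MoonenZarhin1999_hodgeClasses_abelian_dim_le_five_of_weilClassesFourfolds :=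
  fun _ ↦ Markman2025_hodgeClasses_algebraic_abelian_dim_le_five_of_hodgeConjectureFor h

/-- The `dim ≤ 5` claim of the tree (`Markman2025_hodgeClasses_algebraic_abelian_dim_le_five`,
arXiv:2509.23403 Cor. 1.3, tagged unrefereed) trivially implies the reduction; conversely the
reduction and the fourfold Weil fact give the claim back
(`dim_le_five_of_moonenZarhin_of_weilFourfolds`), which is how Cor. 1.3 is proved in print. [cite: Markman2025SurveySecant, Cor. 1.3] -/
theorem MoonenZarhin1999_of_dim_le_five (h : Markman2025_hodgeClasses_algebraic_abelian_dim_le_five) :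
    Literature.AlgebraicGeometry.HodgeTheory.MoonenZarhin1999_hodgeClasses_abelian_dim_le_five_of_weilClassesFourfolds :=
  fun _ ↦ h

/-- Cor. 1.3 as proved in print: Moonen–Zarhin's reduction plus the fourfold Weil theorem give the
`dim ≤ 5` statement. [cite: Markman2025SurveySecant, Cor. 1.3] -/
theorem dim_le_five_of_moonenZarhin_of_weilFourfolds
    (hMZ : Literature.AlgebraicGeometry.HodgeTheory.MoonenZarhin1999_hodgeClasses_abelian_dim_le_five_of_weilClassesFourfolds)
    (hW : Markman2025_weilClasses_algebraic_abelianFourfold) :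
    Markman2025_hodgeClasses_algebraic_abelian_dim_le_five :=
  hMZ hW

/-! ### The route antecedent at `n = 2` is the fourfold Weil fact -/

/-- **`TropicalCuspLift.WeilClassesAlgebraic` at `n = 2` is `Markman2025_weilClasses_algebraic_abelianFourfold`**:
the item's inline eigen-decomposition `c = c₁ + c₂` is membership in `weilClassesOf A φ 2 d`
(`mem_weilClassesOf_iff`). [cite: vanGeemen1994HodgeAV, 4.9 and proof of Thm. 6.12] -/
theorem weilClassesFourfolds_of_weilClassesAlgebraic
    (h : Summit.HodgeConjecture.HodgeConjecture.Theses.TropicalCuspLift.WeilClassesAlgebraic) :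
    Markman2025_weilClasses_algebraic_abelianFourfold :=
  fun d hd A φ hA hX hφ c hc hH hw ↦ h 2 le_rfl d hd A φ hA hX hφ c hc hH (mem_weilClassesOf_iff.1 hw)

/-! ### P2 — the Weil sector suffices up to dimension `5` (modulo Moonen–Zarhin) -/

/-- `dim A ≤ 5` from the Moonen–Zarhin reduction and the fourfold Weil fact, in the summit layer's
spelling, with the anti-vacuity conjunct DISCHARGED (`nonempty_hodgeModel_holds`) and projectivity
PROVED (`AbelianVariety.isSmoothProjective_holds`). [cite: Markman2025SurveySecant, Cor. 1.3]
[cite: MoonenZarhin1999LowDim, Thm. 0.1 and Thm. 0.2] -/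
theorem hodgeAbelianVarieties_dim_le_five_of_moonenZarhin_of_weilFourfolds
    (hMZ : Literature.AlgebraicGeometry.HodgeTheory.MoonenZarhin1999_hodgeClasses_abelian_dim_le_five_of_weilClassesFourfolds)
    (hW : Markman2025_weilClasses_algebraic_abelianFourfold) (A : AbelianVariety ℂ) (hd : A.dim ≤ 5) :
    HodgeConjectureFor A.dim A.X :=
  hodgeConjectureFor_abelian_of_dim_le_five_of (hMZ hW) A nonempty_hodgeModel_holds hd
    AbelianVariety.isSmoothProjective_holds

/-- **REGISTERED PARTIAL of `stub_weilSectorSuffices` — the imaginary-quadratic Weil sector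
suffices for the Hodge conjecture on abelian varieties of dimension `≤ 5`, modulo the Moonen–Zarhin
reduction (named fact).** The route antecedent at `n = 2` supplies Moonen–Zarhin's input
(`weilClassesFourfolds_of_weilClassesAlgebraic`); Hodge models and projectivity are theorems.
[cite: MoonenZarhin1999LowDim, Thm. 0.1 and Thm. 0.2] [cite: Markman2025SurveySecant, Cor. 1.3] -/
theorem weilSectorSuffices_dim_le_five :
    Literature.AlgebraicGeometry.HodgeTheory.MoonenZarhin1999_hodgeClasses_abelian_dim_le_five_of_weilClassesFourfolds → Summit.HodgeConjecture.HodgeConjecture.Theses.TropicalCuspLift.WeilClassesAlgebraic → ∀ A : AbelianVariety ℂ, A.dim ≤ 5 → HodgeConjectureFor A.dim A.X :=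
  fun hMZ hW A hd ↦ hodgeAbelianVarieties_dim_le_five_of_moonenZarhin_of_weilFourfolds hMZ
    (weilClassesFourfolds_of_weilClassesAlgebraic hW) A hd

/-- **Granted Moonen–Zarhin and the Weil sector, the crux is its part `dim A ≥ 6`** — the first
dimension where print is open (Weil classes on sixfolds of non-split Weil type, arXiv:2603.20268
p. 3). [cite: Markman2025SurveySecant, Cor. 1.3] -/
theorem hodgeAbelianVarieties_iff_six_le_dim
    (hMZ : Literature.AlgebraicGeometry.HodgeTheory.MoonenZarhin1999_hodgeClasses_abelian_dim_le_five_of_weilClassesFourfolds)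
    (hW : Summit.HodgeConjecture.HodgeConjecture.Theses.TropicalCuspLift.WeilClassesAlgebraic) :
    Summit.HodgeConjecture.HodgeConjecture.Theses.PadicSemiregularLift.HodgeAbelianVarieties ↔
      ∀ A : AbelianVariety ℂ, 6 ≤ A.dim → HodgeConjectureFor A.dim A.X := by
  refine ⟨fun h A _ ↦ h A, fun h A ↦ ?_⟩
  rcases Nat.lt_or_ge A.dim 6 with hlt | hge
  · exact weilSectorSuffices_dim_le_five hMZ hW A (by omega)
  · exact h A hge

/-- **REGISTERED residual form of `stub_weilSectorSuffices`**: modulo the Moonen–Zarhin fact, the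
stub `WeilClassesAlgebraic → HodgeAbelianVarieties` holds as soon as the Hodge conjecture holds for
abelian varieties of dimension `≥ 6` — the honest residue of the complement (open in print).
[cite: Markman2025SurveySecant, Cor. 1.3] -/
theorem weilSectorSuffices_of_six_le_dim :
    Literature.AlgebraicGeometry.HodgeTheory.MoonenZarhin1999_hodgeClasses_abelian_dim_le_five_of_weilClassesFourfolds → Summit.HodgeConjecture.HodgeConjecture.Theses.TropicalCuspLift.WeilClassesAlgebraic → (∀ A : AbelianVariety ℂ, 6 ≤ A.dim → HodgeConjectureFor A.dim A.X) → Summit.HodgeConjecture.HodgeConjecture.Theses.PadicSemiregularLift.HodgeAbelianVarieties :=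
  fun hMZ hW h6 ↦ (hodgeAbelianVarieties_iff_six_le_dim hMZ hW).2 h6

/-- The same `dim ≤ 5` conclusion from the tree's unrefereed `dim ≤ 5` claim alone (no Weil input),
Hodge models discharged: what the crux's low-dimensional part costs if one trusts arXiv:2509.23403
Cor. 1.3 as a black box. [cite: Markman2025SurveySecant, Cor. 1.3] -/
theorem hodgeAbelianVarieties_dim_le_five_of_claim
    (h : Markman2025_hodgeClasses_algebraic_abelian_dim_le_five) (A : AbelianVariety ℂ)
    (hd : A.dim ≤ 5) : HodgeConjectureFor A.dim A.X :=
  hodgeConjectureFor_abelian_of_dim_le_five_of h A nonempty_hodgeModel_holds hd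
    AbelianVariety.isSmoothProjective_holds

/-! ### P1 — dimension `≤ 3` (no Weil input) -/

/-- **REGISTERED PARTIAL — `dim A ≤ 3`** from the tree's named fact
`hodgeClasses_algebraic_of_dim_le_three` (Voisin II, proof of Prop. 10.26: Lefschetz `(1,1)` and
`L : H² ≅ H⁴`), with the Hodge-model conjunct DISCHARGED (`nonempty_hodgeModel_holds`) — the
Negative lemma `of_dim_le_three` with its second hypothesis now a theorem.
[cite: VoisinHodgeII2003, §10.2.3 proof of Prop. 10.26] -/
theorem hodgeAbelianVarieties_dim_le_three :
    Literature.AlgebraicGeometry.HodgeTheory.hodgeClasses_algebraic_of_dim_le_three → ∀ A : AbelianVariety ℂ, A.dim ≤ 3 → HodgeConjectureFor A.dim A.X :=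
  fun h3 A hd ↦ Negative.of_dim_le_three h3 (fun _ _ ↦ nonempty_hodgeModel_holds) A hd

/-- `dim A ≤ 3` from the two finer named facts the tree reduces it to: Lefschetz `(1,1)`
(`lefschetzOneOne_rational`) and the Lefschetz isomorphism of an ample class on a threefold
(`nonempty_hardLefschetzThreefold`), via `hodgeClasses_algebraic_of_dim_le_three_of`.
[cite: VoisinHodgeII2003, §10.2.3 proof of Prop. 10.26] [cite: VoisinHodgeI2002, Thm. 6.25 and Thm. 11.30] -/
theorem hodgeAbelianVarieties_dim_le_three_of_lefschetz (h1 : lefschetzOneOne_rational)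
    (h4 : ∀ X : SchemeOver ℂ, nonempty_hardLefschetzThreefold X) (A : AbelianVariety ℂ)
    (hd : A.dim ≤ 3) : HodgeConjectureFor A.dim A.X :=
  hodgeAbelianVarieties_dim_le_three (hodgeClasses_algebraic_of_dim_le_three_of h1 h4) A hd

/-! ### P3 — the divisor-generated sector (Mattuck / Tate / Tankeev–Ribet: `Bᵖ = Dᵖ`) -/

/-- **Divisor monomials are algebraic on an abelian variety, granted Lefschetz `(1,1)`**: a
`p`-fold cup product of rational `(1,1)`-classes lies in `Nᵖ H²ᵖ` — induction on `p`, the factor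
being a divisor class by `lefschetzOneOne_rational` and the product with it staying algebraic by the
tree's THEOREM `AbelianVariety.cupProduct_mem_algebraicClasses_one` (move the divisor by a general
translate). [cite: vanGeemen1994HodgeAV, §2.4] [cite: VoisinHodgeII2003, §9.2.4 Prop. 9.20] -/
theorem divisorMonomials_subset_algebraicClasses (h11 : lefschetzOneOne_rational)
    (A : AbelianVariety ℂ) (p : ℕ) :
    Literature.Barriers.HodgeConjecture.divisorMonomials A.X A.dim p ⊆
      (algebraicClasses A.X p : Set (complexBetti A.X (2 * p))) := by
  induction p with
  | zero =>
      intro c _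
      exact hodgeConjectureFor_codim_zero c
  | succ p ih =>
      intro c hc
      obtain ⟨a, ha, b, hb, hb', rfl⟩ :=
        Literature.Barriers.HodgeConjecture.mem_divisorMonomials_succ.1 hc
      have hX : IsSmoothProjective A.dim A.X := AbelianVariety.isSmoothProjective_holds
      have ha' : a ∈ algebraicClasses A.X p := ih ha
      have hb1 : b ∈ algebraicClasses A.X 1 := h11 hX b hb hb'
      exact AbelianVariety.cupProduct_mem_algebraicClasses_one A ha' hb1

/-- **`Dᵖ ⊗ ℂ ⊆ Nᵖ H²ᵖ` on an abelian variety, granted Lefschetz `(1,1)`** (the hypothesis `hcup` of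
the disprover's `cyclePart_of_divisorGenerated`, Disproof §8, now a theorem modulo Lefschetz `(1,1)`).
[cite: vanGeemen1994HodgeAV, §2.4] -/
theorem divisorClassesSpan_le_algebraicClasses (h11 : lefschetzOneOne_rational)
    (A : AbelianVariety ℂ) (p : ℕ) :
    Literature.Barriers.HodgeConjecture.divisorClassesSpan A.X A.dim p ≤ algebraicClasses A.X p :=
  Submodule.span_le.2 (divisorMonomials_subset_algebraicClasses h11 A p)

/-- **REGISTERED PARTIAL — the divisor-generated sector**: granted Lefschetz `(1,1)`, an abelian
variety whose rational `(p,p)`-classes are all `ℂ`-combinations of `p`-fold products of rational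
`(1,1)`-classes (`Bᵖ = Dᵖ` for all `p`: general abelian varieties — Mattuck; products of elliptic
curves — Tate, Imai, Murasaki; simple of prime dimension — Tankeev, Ribet) satisfies the Hodge
conjecture (Hodge models discharged). "In particular, if `Dᵖ = Bᵖ`, then the Hodge `(p,p)`-conjecture
is true for `X`" (van Geemen §2.4). [cite: vanGeemen1994HodgeAV, §2.4, Thms. 4.2, 4.3 and 4.6] -/
theorem hodgeConjectureFor_of_divisorGenerated :
    Literature.AlgebraicGeometry.HodgeTheory.lefschetzOneOne_rational → ∀ A : AbelianVariety ℂ, (∀ (p : ℕ) (c : Literature.AlgebraicTopology.SingularHomology.singularCohomology ℂ ℂ (ComplexPoints A.X) (2 * p)), IsRationalClass c → IsOfHodgeType A.dim A.X (2 * p) p p c → c ∈ Literature.Barriers.HodgeConjecture.divisorClassesSpan A.X A.dim p) → HodgeConjectureFor A.dim A.X :=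
  fun h11 A hD ↦
    ⟨nonempty_hodgeModel_holds (AbelianVariety.isSmoothProjective_holds (A := A)),
      fun p c hc hH ↦ divisorClassesSpan_le_algebraicClasses h11 A p (hD p c hc hH)⟩

/-! ### P4 — audit of the stub's shape -/

/-- **The antecedent is implied by the crux**: `HodgeAbelianVarieties → TropicalCuspLift.WeilClassesAlgebraic`
(specialise at `A.dim = 2n`, `p = n`; the positive form of the kill-transfer lemma
`Negative.not_of_not_tropicalCuspLift_weilClassesAlgebraic`). So the stub is not vacuously true for a
typing reason unless the crux itself fails. [cite: Weil1977HodgeRing] -/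
theorem weilClassesAlgebraic_of_hodgeAbelianVarieties
    (h : Summit.HodgeConjecture.HodgeConjecture.Theses.PadicSemiregularLift.HodgeAbelianVarieties) :
    Summit.HodgeConjecture.HodgeConjecture.Theses.TropicalCuspLift.WeilClassesAlgebraic := by
  intro n _ d _ A φ hA _ _ c hc hH _
  have h2 := (h A).2 n c
  rw [hA] at h2
  exact h2 hc hH

/-- **What the stub says**: it is implied by its own conclusion (`fun h _ ↦ h`: irrefutable unless HC
fails on an abelian variety), and since its antecedent is a consequence of its conclusion, the stub
`WeilClassesAlgebraic → HodgeAbelianVarieties` is equivalent to "HC holds on every abelian variety, OR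
it already fails at a rational `(n,n)`-class of an imaginary-quadratic Weil plane" — open (a failure at
a Weil class for a CM field of degree `> 2`, or off the Weil sector, with all imaginary-quadratic Weil
classes algebraic, is not excluded by anything in print). [folklore] -/
theorem weilSectorSuffices_iff :
    (Summit.HodgeConjecture.HodgeConjecture.Theses.TropicalCuspLift.WeilClassesAlgebraic →
        Summit.HodgeConjecture.HodgeConjecture.Theses.PadicSemiregularLift.HodgeAbelianVarieties) ↔
      (Summit.HodgeConjecture.HodgeConjecture.Theses.PadicSemiregularLift.HodgeAbelianVarieties ∨
        ¬ Summit.HodgeConjecture.HodgeConjecture.Theses.TropicalCuspLift.WeilClassesAlgebraic) := by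
  constructor
  · intro h
    by_cases hW : Summit.HodgeConjecture.HodgeConjecture.Theses.TropicalCuspLift.WeilClassesAlgebraic
    · exact Or.inl (h hW)
    · exact Or.inr hW
  · rintro (h | h) hW
    · exact h
    · exact absurd hW h

/-- **The antecedent's hypothesis list is satisfiable on every instance of its binders** (at the zero
class): for any `(A, φ, n, d)` with `A` smooth projective of dimension `2n`, `c = 0` is rational, of
Hodge type `(n,n)` (a Hodge model exists: `nonempty_hodgeModel_holds`) and lies in the Weil plane; and
it is algebraic, consistently. [folklore] -/
theorem weilClassesAlgebraic_hypotheses_zero (A : AbelianVariety ℂ) (φ : A ⟶ A) (n d : ℕ)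
    (hA : A.dim = 2 * n) :
    IsRationalClass (0 : complexBetti A.X (2 * n)) ∧ IsOfHodgeType (2 * n) A.X (2 * n) n n 0 ∧
      (0 : complexBetti A.X (2 * n)) ∈ weilClassesOf A φ n d ∧
      (0 : complexBetti A.X (2 * n)) ∈ algebraicClasses A.X n := by
  have hX : IsSmoothProjective (2 * n) A.X := hA ▸ AbelianVariety.isSmoothProjective_holds
  exact ⟨IsRationalClass.zero, isOfHodgeType_zero_of_isSmoothProjective nonempty_hodgeModel_holds hX _ _ _,
    Submodule.zero_mem _, Submodule.zero_mem _⟩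

/-- **The antecedent's binders are inhabited in every half-dimension**: for all `n ≥ 1`, `d ≥ 1`
there is a complex abelian `2n`-fold `A` (smooth projective of dimension `2n`) with `φ : A ⟶ A`,
`φ ≫ φ = -(d • 𝟙 A)` — the `n`-fold self-product of the tree's Weil surface `E_i × E_i` with its
companion endomorphism (`exists_weilType_abelianSurfaces_holds`, PROVED), by `dim_prod_eq_two_mul`
and `prodLift_comp_self_eq_neg_nsmul`. With `weilClassesAlgebraic_hypotheses_zero`, every instance
`(n, d)` of `TropicalCuspLift.WeilClassesAlgebraic` has its full hypothesis list satisfied (at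
`c = 0`): the stub's antecedent is not an implication over an empty binder. [folklore] -/
theorem exists_abelianVariety_comp_self_eq_neg (n : ℕ) (hn : 0 < n) (d : ℕ) (hd : 0 < d) :
    ∃ (A : AbelianVariety ℂ) (φ : A ⟶ A),
      A.dim = 2 * n ∧ IsSmoothProjective (2 * n) A.X ∧ φ ≫ φ = -(d • 𝟙 A) := by
  suffices h : ∃ (A : AbelianVariety ℂ) (φ : A ⟶ A), A.dim = 2 * n ∧ φ ≫ φ = -(d • 𝟙 A) by
    obtain ⟨A, φ, hA, hφ⟩ := h
    exact ⟨A, φ, hA, hA ▸ AbelianVariety.isSmoothProjective_holds, hφ⟩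
  induction n with
  | zero => exact absurd hn (lt_irrefl 0)
  | succ n ih =>
      obtain ⟨B, ψ, -, hB, hψ, -⟩ := exists_weilType_abelianSurfaces_holds d hd
      have hB' : B.dim = 2 * 1 := by rw [hB]
      rcases Nat.eq_zero_or_pos n with rfl | hn0
      · exact ⟨B, ψ, hB', hψ⟩
      · obtain ⟨A, φ, hA, hφ⟩ := ih hn0
        exact ⟨A.prod B, _, dim_prod_eq_two_mul hA hB', prodLift_comp_self_eq_neg_nsmul hφ hψ⟩

end Summit.HodgeConjecture.HodgeConjecture.Cruxes.HodgeAbelianVarieties.EStepSecantInduction.Stubs.WeilSector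

end
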